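import Summits.AtomisticToContinuum.FouriersLaw.Theorems.BondHeatUncertaintySubdiffusiveBondHeatJunctionGradedCalibration

/-!
# The ratio ladder of the junction laws: `SeriesRatioLaw ρ` — necessity stops at `ρ < 1`, sufficiency for 11071 starts at `ρ = 1`

SPLIT (lean/CONVENTIONS.md §32, ≤ 400 lines per Theorems file; critic row 802; lens-1 gen 60).  This is PART (a) of the gen-58 file (13):
§A–§C below, byte-for-byte the gen-58 text.  PART (b) — §D `SubOhmicBootstrap` and §E the nodes — is `…JunctionRatioBootstrap` (imports this
file).  The rest of this docstring is file (13)'s, unchanged; «this file» below means parts (a)+(b) together.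

Support file for stmt-AtomisticToContinuum-11071 (`BondHeatUncertainty.BoundedResponse` ⟺ `OhmicFloor`: `E_N(T) ≤ C₁/N`), decomposition
cell `decomp-a2c`, lens-1 (grading / quantitative ladder), gen 58 — file (13) (imports (12)).  Conjunct of record N_F = `FouriersLaw`
(residual 11071 ∧ 9121).

THE GRADE.  Every junction law of files (2)–(12) is an ABSOLUTE defect law `r_u + r_v − defect ≤ r_{u+L₀+v}` for the escape resistance
`r_N = 1/E_N(T)`; their calibration (file (12), `not_linear_kernel_at_one`) showed that the Fourier-NECESSARY absolute form (defect `o(N)`)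
does not bootstrap, while the bootstrapping forms (defect `O(N^θ)`, `θ < 1`) are not necessary.  This file grades the junction axis by the
RELATIVE defect instead — the slack `ρ` in `ρ·(r_u + r_v) ≤ r_{u+L₀+v}` (`SeriesRatioLaw ρ`, rate-free, no constants) — and locates the
conjecture EXACTLY on that axis:
* `ρ ≤ 0`      PROVED (`seriesRatioLaw_of_nonpos`);
* `0 < ρ < 1`  NECESSARY: `FouriersLaw ⟹ SeriesRatioLaw ρ` (`seriesRatioLaw_of_fouriersLaw`: `(N−1)γ·E_N(T) → κ(T) > 0` squeezes the
  ratio to `1`); delivers the transport-exponent rung `F(s) = ExponentFloor s` with `2^s = 2ρ` (`exponentFloor_of_seriesRatioLaw`; dictionary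
  `s = 1 + log₂ ρ`, SHARP — companion file `…JunctionRatioCalibration`, `not_rpow_kernel_above`); any single rung `ρ > 1/2` already gives
  `NoBallisticChannel` (stmt-28286) (`noBallisticChannel_of_seriesRatioLaw`);
* `ρ → 1⁻`     `AsymptoticSeriesLaw := ∀ ρ < 1, SeriesRatioLaw ρ`: NECESSARY (`asymptoticSeriesLaw_of_fouriersLaw`), delivers EVERY `F(s)`,
  `s < 1` (`exponentFloor_of_asymptoticSeriesLaw`; hence `HalfOhmicFloor`, `EscapeVanishing`, 28286, `NonBallistic` 9127, `EscapeInfZeroPow θ`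
  for `θ < 1`), and NOT `F(1)` ⟺ 11071 (companion: `r_N = N/log N`, `not_linear_kernel_of_asymptoticRatio`);
* `ρ = 1`      ⟺ `BufferedSeriesLaw` of file (3) (`seriesRatioLaw_one_iff`): SUFFICIENT (`boundedResponse_of_seriesRatioLaw_one`), NOT
  necessary (companion: `r_N = N + √N`, `not_bufferedSeries_of_asymptoticRatio`);
* `ρ > 1`      stronger still (`seriesRatioLaw_anti`).
So on the junction axis the necessary part of the ladder is `ρ < 1` and the sufficient part is `ρ ≥ 1`, with nothing in between: «the
last epsilon is logarithmic».  The missing input is typed as the weakest bootstrap this lineage has stated, `SubOhmicBootstrap` (per `T`: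
`(∀ s < 1, E_N ≤ C_s/N^s eventually) ⟹ E_N ≤ C₁/N eventually`) — NECESSARY (implied by 11071), strictly weaker than `NoAnomalousChannel`
(stmt-28285, whose hypothesis is only `D_N/N → 0`) and than every graded bootstrap `ExponentBootstrap a` pointwise, implied by
`BufferedJunctionLaw` — giving the node out of two NECESSARY pieces `AsymptoticSeriesLaw ∧ SubOhmicBootstrap ⟹ 11071`, next to the
mechanism nodes `SeriesRatioLaw ρ ∧ BufferedJunctionLaw ⟹ 11071` (any `ρ > 1/2`), `AsymptoticSeriesLaw ∧ LocalityPassivityLaw ⟹ 11071`, and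
the graded `SeriesRatioLaw ρ ∧ BufferedJunctionLawPow θ ⟹ 11071` (`2^θ < 2ρ`), hence `AsymptoticSeriesLaw ∧ BufferedJunctionLawPow θ ⟹ 11071` and
`AsymptoticSeriesLaw ∧ JunctionLaw θ ⟹ 11071` for EVERY `0 ≤ θ < 1`: a NECESSARY relative law now discharges the
floor partner (`ExponentFloor s` / `EscapeInfZeroPow θ` / `NonBallistic`) of every junction node of files (5), (9), (11).

Contents.  §A kernel `rpow_of_ratioJunction` (pure sequences: ratio law + `r ≥ 1` ⟹ `r_N ≥ c·N^s` whenever `2^s ≤ 2ρ`, along the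
doubling chain `dblChain` of file (11)) and `escapeFloor_rpow_of_ratioJunctionAt`; §B `SeriesRatioLaw`, `AsymptoticSeriesLaw`, calibration
at `ρ ≤ 0` and `ρ = 1`, monotonicity, the exponent dictionary and its corollaries; §C necessity: `escapeAsymptotics_of_fouriersLaw`
(`FouriersLaw ⟹ (N−1)γE_N(T) → κ(T) > 0`, from `exists_canonical_response` and uniqueness of `δ`-limits), `seriesRatioLaw_of_fouriersLaw`,
`asymptoticSeriesLaw_of_fouriersLaw`; §D `SubOhmicBootstrap` with `…_of_boundedResponse`, `…_of_bufferedJunctionLaw`,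
`…_of_noAnomalousChannel`; §E the nodes.
TAGS (lens-1 convention).  `SeriesRatioLaw ρ` (`0 < ρ < 1`) and `AsymptoticSeriesLaw`: WEAKER (FL-necessary; not implied by 11071 at
sequence level; the harmonic analogue fails for `ρ > 1/2`, where `r_N` stays bounded) · UNDECIDED · IDEA-NEEDED (a bulk resistivity =
RELATIVE locality of the escape resistance; no owner) · INSTRUMENTABLE (census ratio `r_{u+L₀+v}/(r_u + r_v)` from the `E_N(T)` table, cell
(64,96,64)|224 at `T = 10`).  `SubOhmicBootstrap`: WEAKER (11071-necessary; `<` 28285; `<` every `ExponentBootstrap a` pointwise) ·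
UNDECIDED · IDEA-NEEDED.  `BufferedJunctionLaw`: UNDECIDED, not necessary.  No `sorry`; standard axioms; nothing here closes an item.
-/

noncomputable section

open MeasureTheory Filter Topology Set
open scoped BigOperators

namespace Summit.AtomisticToContinuum.FouriersLaw.Theorems.SubdiffusiveBondHeat

namespace EscapeGrading

open Literature.MathematicalPhysics.KineticTheory.HeatConduction
open Summit.AtomisticToContinuum.FouriersLaw.Theses.BondHeatUncertainty (BoundedResponse NonBallistic)
open Summit.AtomisticToContinuum.FouriersLaw.Theses.ChannelExclusionTauberian (NoBallisticChannel NoAnomalousChannel)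

/-! ## A. The kernel: a ratio law `ρ·(r_u + r_v) ≤ r_{u+L₀+v}` with `2ρ ≥ 2^s` gives `r_N ≥ c·N^s` (pure sequence analysis) -/

/-- **THE RATIO KERNEL.**  If `r ≥ 1` beyond `N₂ ≥ 1` and `ρ·(r_u + r_v) ≤ r_{u+L₀+v}` for all `u, v ≥ N₂`, then for every `s ≥ 0` with
`2^s ≤ 2ρ`: `c·N^s ≤ r_N` for `N ≥ 2N₂ + L₀`, with `c = ρ/(2(2N₂+L₀))^s`.  Proof: along the doubling chain `N_{j+1} = N_j + L₀ + N_j`,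
`N_0 = N₂`, `r_{N_j} ≥ (2ρ)^j ≥ (2^s)^j = (2^j)^s`; a general `N = N_j + L₀ + m` with `m ≥ N₂` and `j` maximal has `r_N ≥ ρ·r_{N_j}` and
`N < 2^{j+1}(2N₂ + L₀)`.  At `ρ = 1`, `s = 1` this is the linear growth behind `boundedResponse_of_bufferedSeriesLaw`. [kernel] -/
theorem rpow_of_ratioJunction {r : ℕ → ℝ} {ρ s : ℝ} {L₀ N₂ : ℕ} (hs : 0 ≤ s) (hρs : (2 : ℝ) ^ s ≤ 2 * ρ)
    (hr1 : ∀ n : ℕ, N₂ ≤ n → 1 ≤ r n)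
    (hJ : ∀ u v : ℕ, N₂ ≤ u → N₂ ≤ v → ρ * (r u + r v) ≤ r (u + L₀ + v)) (hN₂ : 1 ≤ N₂) :
    ∃ c : ℝ, 0 < c ∧ ∃ N₀ : ℕ, ∀ N : ℕ, N₀ ≤ N → c * (N : ℝ) ^ s ≤ r N := by
  have h2s : 0 < (2 : ℝ) ^ s := Real.rpow_pos_of_pos two_pos s
  have hρ : 0 < ρ := by linarith
  have h2ρ : 0 ≤ 2 * ρ := by linarith
  -- the chain minorant `(2ρ)^j ≤ r (N_j)`
  have hchain : ∀ j : ℕ, (2 * ρ) ^ j ≤ r (dblChain N₂ L₀ j) := by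
    intro j
    induction j with
    | zero => simpa [dblChain] using hr1 N₂ le_rfl
    | succ j ih =>
      have hNj : N₂ ≤ dblChain N₂ L₀ j := (le_dblChain N₂ L₀ hN₂ j).1
      have h := hJ _ _ hNj hNj
      show (2 * ρ) ^ (j + 1) ≤ r (dblChain N₂ L₀ j + L₀ + dblChain N₂ L₀ j)
      rw [pow_succ]
      nlinarith [mul_nonneg (sub_nonneg.2 ih) h2ρ, pow_nonneg h2ρ j]
  obtain ⟨K, hK⟩ : ∃ K : ℕ, K = 2 * N₂ + L₀ := ⟨_, rfl⟩
  have hK1 : (1 : ℝ) ≤ K := by rw [hK]; exact_mod_cast (show 1 ≤ 2 * N₂ + L₀ by omega)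
  have hKpos : (0 : ℝ) < K := lt_of_lt_of_le one_pos hK1
  refine ⟨ρ / ((2 : ℝ) * K) ^ s, by positivity, 2 * N₂ + L₀, fun N hN => ?_⟩
  -- locate `N` between two consecutive chain scales
  have hex : ∃ j : ℕ, N < dblChain N₂ L₀ (j + 1) + L₀ + N₂ := by
    refine ⟨N, ?_⟩
    have h := (le_dblChain N₂ L₀ hN₂ (N + 1)).2
    have h2 : N < 2 ^ (N + 1) := lt_trans Nat.lt_two_pow_self (Nat.pow_lt_pow_right (by norm_num) (Nat.lt_succ_self N))
    omega
  classical
  obtain ⟨j, hj, hjmin⟩ : ∃ j : ℕ, N < dblChain N₂ L₀ (j + 1) + L₀ + N₂ ∧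
      ∀ m : ℕ, m < j → ¬ N < dblChain N₂ L₀ (m + 1) + L₀ + N₂ :=
    ⟨Nat.find hex, Nat.find_spec hex, fun m hm => Nat.find_min hex hm⟩
  have hj' : dblChain N₂ L₀ j + L₀ + N₂ ≤ N := by
    rcases Nat.eq_zero_or_pos j with h0 | hpos
    · subst h0
      show N₂ + L₀ + N₂ ≤ N
      omega
    · have h := hjmin (j - 1) (by omega)
      rw [Nat.sub_add_cancel hpos] at h
      omega
  -- split `N = N_j + L₀ + m`, `m ≥ N₂`
  have hNj : N₂ ≤ dblChain N₂ L₀ j := (le_dblChain N₂ L₀ hN₂ j).1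
  have hm : N₂ ≤ N - (dblChain N₂ L₀ j + L₀) := by omega
  have hsplit : dblChain N₂ L₀ j + L₀ + (N - (dblChain N₂ L₀ j + L₀)) = N := by omega
  have hlaw := hJ (dblChain N₂ L₀ j) (N - (dblChain N₂ L₀ j + L₀)) hNj hm
  rw [hsplit] at hlaw
  have hrm : 1 ≤ r (N - (dblChain N₂ L₀ j + L₀)) := hr1 _ hm
  have hrN : ρ * (2 * ρ) ^ j ≤ r N := by nlinarith [hchain j, mul_nonneg hρ.le (le_trans zero_le_one hrm)]
  -- size: `N < N_{j+1} + L₀ + N₂ ≤ 2^{j+1}·K`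
  have hsizeN : dblChain N₂ L₀ (j + 1) + L₀ + N₂ ≤ 2 ^ (j + 1) * K := by
    have h1 := dblChain_add_le N₂ L₀ j
    have h1' : 1 ≤ 2 ^ j := Nat.one_le_two_pow
    show dblChain N₂ L₀ j + L₀ + dblChain N₂ L₀ j + L₀ + N₂ ≤ 2 ^ (j + 1) * K
    rw [pow_succ, hK]
    nlinarith
  have hsize : (N : ℝ) ≤ (2 : ℝ) ^ j * (2 * K) := by
    have h : (N : ℝ) ≤ ((2 ^ (j + 1) * K : ℕ) : ℝ) := by exact_mod_cast (hj.le.trans hsizeN)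
    have e : ((2 ^ (j + 1) * K : ℕ) : ℝ) = (2 : ℝ) ^ j * (2 * K) := by push_cast; ring
    linarith [e ▸ h]
  have hq : (N : ℝ) / (2 * K) ≤ (2 : ℝ) ^ j := by
    rw [div_le_iff₀ (by positivity)]
    exact hsize
  have hNn : (0 : ℝ) ≤ N := Nat.cast_nonneg N
  have hpow : ((N : ℝ) / (2 * K)) ^ s ≤ (2 * ρ) ^ j :=
    calc ((N : ℝ) / (2 * K)) ^ s ≤ ((2 : ℝ) ^ j) ^ s := Real.rpow_le_rpow (by positivity) hq hs
      _ = ((2 : ℝ) ^ s) ^ j := two_pow_rpow_comm j s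
      _ ≤ (2 * ρ) ^ j := pow_le_pow_left₀ h2s.le hρs j
  rw [Real.div_rpow hNn (by positivity)] at hpow
  have hKs : 0 < ((2 : ℝ) * K) ^ s := Real.rpow_pos_of_pos (by positivity) s
  calc ρ / ((2 : ℝ) * K) ^ s * (N : ℝ) ^ s = ρ * ((N : ℝ) ^ s / ((2 : ℝ) * K) ^ s) := by ring
    _ ≤ ρ * (2 * ρ) ^ j := mul_le_mul_of_nonneg_left hpow hρ.le
    _ ≤ r N := hrN

/-- **Per-temperature kernel in escape-deficit currency.**  A ratio law `ρ·(1/E_u + 1/E_v) ≤ 1/E_{u+L₀+v}` (`u, v ≥ N₂`) at `T` with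
`2^s ≤ 2ρ`, `s ≥ 0`, gives `E_N(T) ≤ C/N^s` eventually (`1/E_N ≥ 1` from the tree's `0 < E_N ≤ 1`). [kernel] -/
theorem escapeFloor_rpow_of_ratioJunctionAt {ω₂ lam β γ T : ℝ} (hω : 0 < ω₂) (hl : 0 < lam) (hβ : 0 < β) (hγ : 0 < γ)
    (hT : 0 < T) {ρ s : ℝ} {L₀ N₂ : ℕ} (hs : 0 ≤ s) (hρs : (2 : ℝ) ^ s ≤ 2 * ρ)
    (hJ : ∀ u v : ℕ, N₂ ≤ u → N₂ ≤ v →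
      ρ * (1 / escapeDeficit ω₂ lam β γ T u + 1 / escapeDeficit ω₂ lam β γ T v)
        ≤ 1 / escapeDeficit ω₂ lam β γ T (u + L₀ + v)) :
    ∃ C : ℝ, ∃ N₀ : ℕ, ∀ N : ℕ, N₀ ≤ N → escapeDeficit ω₂ lam β γ T N ≤ C / (N : ℝ) ^ s := by
  have hpos : ∀ N : ℕ, 2 ≤ N → 0 < escapeDeficit ω₂ lam β γ T N := fun N hN =>
    JunctionDefectGrading.escapeDeficit_pos hω hl hβ hγ hT hN
  have hr1 : ∀ n : ℕ, max N₂ 2 ≤ n → 1 ≤ 1 / escapeDeficit ω₂ lam β γ T n := fun n hn =>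
    (one_le_div (hpos n (le_trans (le_max_right _ _) hn))).2
      (escapeDeficit_le_one ω₂ lam β γ hω hl hβ hγ T hT n)
  have hJ' : ∀ u v : ℕ, max N₂ 2 ≤ u → max N₂ 2 ≤ v →
      ρ * (1 / escapeDeficit ω₂ lam β γ T u + 1 / escapeDeficit ω₂ lam β γ T v)
        ≤ 1 / escapeDeficit ω₂ lam β γ T (u + L₀ + v) := fun u v hu hv =>
    hJ u v (le_trans (le_max_left _ _) hu) (le_trans (le_max_left _ _) hv)
  obtain ⟨c, hc, N₀, hfl⟩ := rpow_of_ratioJunction (r := fun N => 1 / escapeDeficit ω₂ lam β γ T N) hs hρs hr1 hJ'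
    (le_trans (by norm_num) (le_max_right N₂ 2))
  refine ⟨1 / c, max N₀ 2, fun N hN => ?_⟩
  have hE := hpos N (le_trans (le_max_right _ _) hN)
  have hNpos : (0 : ℝ) < N := by exact_mod_cast lt_of_lt_of_le (by norm_num) (le_trans (le_max_right N₀ 2) hN)
  have hNs : 0 < (N : ℝ) ^ s := Real.rpow_pos_of_pos hNpos s
  have h : c * (N : ℝ) ^ s ≤ 1 / escapeDeficit ω₂ lam β γ T N := hfl N (le_trans (le_max_left _ _) hN)
  have h' : c * (N : ℝ) ^ s * escapeDeficit ω₂ lam β γ T N ≤ 1 := (le_div_iff₀ hE).mp h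
  rw [div_div, le_div_iff₀ (mul_pos hc hNs)]
  calc escapeDeficit ω₂ lam β γ T N * (c * (N : ℝ) ^ s) = c * (N : ℝ) ^ s * escapeDeficit ω₂ lam β γ T N := by ring
    _ ≤ 1 := h'

/-! ## B. The graded piece `SeriesRatioLaw ρ` and the top of the necessary part, `AsymptoticSeriesLaw` -/

/-- **Series ratio law with slack `ρ`** (`R(ρ)`): for all parameters and `T > 0`, `∃ L₀ N₂ ∀ u v ≥ N₂,
ρ·(1/E_u + 1/E_v) ≤ 1/E_{u+L₀+v}` — across a sacrificed buffer of fixed length the escape resistance of the whole is at least `ρ` times the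
sum of the parts'.  The RELATIVE, RATE-FREE form of the junction laws.  Grades: `ρ ≤ 0` PROVED (`seriesRatioLaw_of_nonpos`);
`0 < ρ < 1` NECESSARY — implied by `FouriersLaw` (`seriesRatioLaw_of_fouriersLaw`), hence STRICTLY WEAKER than the conjunct — yet not
implied by 11071, phonon-false for `ρ > 1/2`, UNDECIDED · IDEA-NEEDED · INSTRUMENTABLE (census ratio `r_{u+L+v}/(r_u+r_v)`, T = 10,
(64,96,64)|224: `> 1` observed); `1/2 < ρ < 1` delivers the exponent rung `F(s)`, `2^s = 2ρ` (`exponentFloor_of_seriesRatioLaw`; SHARP,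
companion file); `ρ = 1` ⟺ `BufferedSeriesLaw` (`seriesRatioLaw_one_iff`) delivers 11071 and is NOT necessary; larger `ρ` = STRONGER
(`seriesRatioLaw_anti`). [piece · rung] -/
def SeriesRatioLaw (ρ : ℝ) : Prop :=
  ∀ ω₂ lam β γ : ℝ, 0 < ω₂ → 0 < lam → 0 < β → 0 < γ → ∀ T : ℝ, 0 < T →
    ∃ L₀ N₂ : ℕ, ∀ u v : ℕ, N₂ ≤ u → N₂ ≤ v →
      ρ * (1 / escapeDeficit ω₂ lam β γ T u + 1 / escapeDeficit ω₂ lam β γ T v)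
        ≤ 1 / escapeDeficit ω₂ lam β γ T (u + L₀ + v)

/-- **Asymptotic series law** (`R(1⁻) := ∀ ρ < 1, R(ρ)`): escape resistances across a fixed buffer are ASYMPTOTICALLY (super)additive.
NECESSARY (`asymptoticSeriesLaw_of_fouriersLaw`) · STRICTLY WEAKER than the conjunct · not implied by 11071 · phonon-false · delivers EVERY
sub-Ohmic rung `F(s)`, `s < 1` (`exponentFloor_of_asymptoticSeriesLaw`), hence `NoBallisticChannel` 28286 and `NonBallistic` 9127, but NOT
`F(1)` = 11071 (sequence witness `N/log N`, companion file) · UNDECIDED · IDEA-NEEDED (the existence of a bulk resistivity: relative locality)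
· INSTRUMENTABLE. [piece · rung] -/
def AsymptoticSeriesLaw : Prop := ∀ ρ : ℝ, ρ < 1 → SeriesRatioLaw ρ

/-- `R(1) ⟺ BufferedSeriesLaw` (file 3). [folklore] -/
theorem seriesRatioLaw_one_iff : SeriesRatioLaw 1 ↔ JunctionDefectGrading.BufferedSeriesLaw := by
  simp only [SeriesRatioLaw, JunctionDefectGrading.BufferedSeriesLaw, one_mul]

/-- `R(ρ)` holds trivially for `ρ ≤ 0` (`1/E > 0`). [folklore] -/
theorem seriesRatioLaw_of_nonpos {ρ : ℝ} (hρ : ρ ≤ 0) : SeriesRatioLaw ρ := by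
  intro ω₂ lam β γ hω hl hβ hγ T hT
  have hpos : ∀ N : ℕ, 2 ≤ N → 0 < 1 / escapeDeficit ω₂ lam β γ T N := fun N hN =>
    one_div_pos.2 (JunctionDefectGrading.escapeDeficit_pos hω hl hβ hγ hT hN)
  refine ⟨0, 2, fun u v hu hv => ?_⟩
  have h1 := hpos u hu
  have h2 := hpos v hv
  have h3 := hpos (u + 0 + v) (by omega)
  nlinarith [mul_nonpos_of_nonpos_of_nonneg hρ (le_of_lt (add_pos h1 h2))]

/-- **Monotonicity of the ratio ladder**: `ρ ≤ ρ' ⟹ R(ρ') ⟹ R(ρ)` (thresholds raised to `2`, where `1/E > 0`). [folklore] -/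
theorem seriesRatioLaw_anti {ρ ρ' : ℝ} (hρρ' : ρ ≤ ρ') : SeriesRatioLaw ρ' → SeriesRatioLaw ρ := by
  intro h ω₂ lam β γ hω hl hβ hγ T hT
  obtain ⟨L₀, N₂, hJ⟩ := h ω₂ lam β γ hω hl hβ hγ T hT
  have hpos : ∀ N : ℕ, 2 ≤ N → 0 < 1 / escapeDeficit ω₂ lam β γ T N := fun N hN =>
    one_div_pos.2 (JunctionDefectGrading.escapeDeficit_pos hω hl hβ hγ hT hN)
  refine ⟨L₀, max N₂ 2, fun u v hu hv => ?_⟩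
  have h1 := hpos u (le_trans (le_max_right _ _) hu)
  have h2 := hpos v (le_trans (le_max_right _ _) hv)
  have h := hJ u v (le_trans (le_max_left _ _) hu) (le_trans (le_max_left _ _) hv)
  nlinarith [mul_le_mul_of_nonneg_right hρρ' (le_of_lt (add_pos h1 h2))]

/-- **`R(ρ) ⟹ F(s)` whenever `2^s ≤ 2ρ`, `s ≥ 0`** — the dictionary «ratio slack ↦ transport exponent», `s(ρ) = 1 + log₂ ρ`. [kernel · frame] -/
theorem exponentFloor_of_seriesRatioLaw {ρ s : ℝ} (hs : 0 ≤ s) (hρs : (2 : ℝ) ^ s ≤ 2 * ρ) (hR : SeriesRatioLaw ρ) :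
    ExponentFloor s := by
  intro ω₂ lam β γ hω hl hβ hγ T hT
  obtain ⟨L₀, N₂, hJ⟩ := hR ω₂ lam β γ hω hl hβ hγ T hT
  exact escapeFloor_rpow_of_ratioJunctionAt hω hl hβ hγ hT hs hρs hJ

/-- `R(1) ⟹ F(1) ⟺ 11071` (`2^1 ≤ 2·1`): the tree node `boundedResponse_of_bufferedSeriesLaw`, recovered from the ratio kernel. [kernel · frame] -/
theorem boundedResponse_of_seriesRatioLaw_one (hR : SeriesRatioLaw 1) : BoundedResponse :=
  exponentFloor_one_iff_boundedResponse.1 (exponentFloor_of_seriesRatioLaw zero_le_one (by rw [Real.rpow_one]; norm_num) hR)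

/-- **`R(1⁻) ⟹ F(s)` for EVERY `s < 1`** (`ρ := 2^s/2 < 1`). [kernel · frame] -/
theorem exponentFloor_of_asymptoticSeriesLaw {s : ℝ} (hs : s < 1) (hA : AsymptoticSeriesLaw) : ExponentFloor s := by
  rcases le_or_gt s 0 with hs0 | hs0
  · exact exponentFloor_of_nonpos_of_le_one hs0
  · have h2s : (2 : ℝ) ^ s < 2 := by
      have h := Real.rpow_lt_rpow_of_exponent_lt (by norm_num : (1 : ℝ) < 2) hs
      rwa [Real.rpow_one] at h
    exact exponentFloor_of_seriesRatioLaw hs0.le (by linarith) (hA ((2 : ℝ) ^ s / 2) (by linarith))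

/-- `R(1⁻) ⟹ HalfOhmicFloor` (`E_N ≤ C/√N`). [kernel · frame] -/
theorem halfOhmicFloor_of_asymptoticSeriesLaw (hA : AsymptoticSeriesLaw) : HalfOhmicFloor :=
  exponentFloor_of_asymptoticSeriesLaw (by norm_num) hA

/-- `R(1⁻) ⟹ EscapeVanishing` (`E_N → 0`). [kernel · frame] -/
theorem escapeVanishing_of_asymptoticSeriesLaw (hA : AsymptoticSeriesLaw) : EscapeVanishing :=
  escapeVanishing_of_exponentFloor (by norm_num : (0 : ℝ) < 1 / 2) (halfOhmicFloor_of_asymptoticSeriesLaw hA)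

/-- **`R(1⁻) ⟹ NoBallisticChannel` (stmt-28286).** [kernel · frame] -/
theorem noBallisticChannel_of_asymptoticSeriesLaw (hA : AsymptoticSeriesLaw) : NoBallisticChannel :=
  noBallisticChannel_of_escapeVanishing (escapeVanishing_of_asymptoticSeriesLaw hA)

/-- **`R(1⁻) ⟹ NonBallistic` (stmt-9127 ≡ stmt-2192).** [kernel · frame] -/
theorem nonBallistic_of_asymptoticSeriesLaw (hA : AsymptoticSeriesLaw) : NonBallistic :=
  nonBallistic_of_noBallisticChannel (noBallisticChannel_of_asymptoticSeriesLaw hA)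

/-- `R(1⁻) ⟹ EscapeInfZeroPow θ` for every `θ < 1` (file 11's graded liminf floors). [kernel · frame] -/
theorem escapeInfZeroPow_of_asymptoticSeriesLaw {θ : ℝ} (hθ : θ < 1) (hA : AsymptoticSeriesLaw) : EscapeInfZeroPow θ := by
  obtain ⟨s, hθs, hs1⟩ := exists_between hθ
  exact escapeInfZeroPow_of_exponentFloor hθs (exponentFloor_of_asymptoticSeriesLaw hs1 hA)

/-- **A single rung above one half already excludes the ballistic channel**: `R(ρ)`, `ρ > 1/2` ⟹ `F(s)` with `s = min 1 (log₂ 2ρ) > 0`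
⟹ `NoBallisticChannel`. [kernel · frame] -/
theorem exponentFloor_pos_of_seriesRatioLaw {ρ : ℝ} (hρ : 1 / 2 < ρ) (hR : SeriesRatioLaw ρ) :
    ∃ s : ℝ, 0 < s ∧ s ≤ 1 ∧ ExponentFloor s := by
  have h2ρ : 1 < 2 * ρ := by linarith
  have hL : 0 < Real.logb 2 (2 * ρ) := Real.logb_pos (by norm_num) h2ρ
  refine ⟨min 1 (Real.logb 2 (2 * ρ)), lt_min one_pos hL, min_le_left _ _, ?_⟩
  refine exponentFloor_of_seriesRatioLaw (lt_min one_pos hL).le ?_ hR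
  calc (2 : ℝ) ^ min 1 (Real.logb 2 (2 * ρ)) ≤ (2 : ℝ) ^ Real.logb 2 (2 * ρ) :=
        Real.rpow_le_rpow_of_exponent_le (by norm_num) (min_le_right _ _)
    _ = 2 * ρ := Real.rpow_logb (by norm_num) (by norm_num) (by linarith)

/-- A series ratio law with exponent `ρ > 1/2` excludes a ballistic channel. -/
theorem noBallisticChannel_of_seriesRatioLaw {ρ : ℝ} (hρ : 1 / 2 < ρ) (hR : SeriesRatioLaw ρ) : NoBallisticChannel := by
  obtain ⟨s, hs, -, hF⟩ := exponentFloor_pos_of_seriesRatioLaw hρ hR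
  exact noBallisticChannel_of_exponentFloor hs hF

/-! ## C. Necessity: `FouriersLaw ⟹ R(ρ)` for every `ρ < 1` -/

/-- **The conjunct fixes the escape asymptotics**: `FouriersLaw ⟹ (N−1)γ·E_N(T) → κ(T) > 0` (canonical steady-state family
`exists_canonical_response`, response identity `D_N = (N−1)γE_N`, uniqueness of the `δ`-limits). [folklore] -/
theorem escapeAsymptotics_of_fouriersLaw (hF : _root_.FouriersLaw) {ω₂ lam β γ : ℝ} (hω : 0 < ω₂) (hl : 0 < lam)
    (hβ : 0 < β) (hγ : 0 < γ) {T : ℝ} (hT : 0 < T) :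
    ∃ κ : ℝ, 0 < κ ∧ Tendsto (fun N : ℕ => ((N : ℝ) - 1) * γ * escapeDeficit ω₂ lam β γ T N) atTop (𝓝 κ) := by
  obtain ⟨μ, hμ, D, hD, hDE⟩ := JunctionDefectGrading.exists_canonical_response hω hl hβ hγ hT
  obtain ⟨-, κ, hκ, hii⟩ := hF ω₂ lam β γ hω hl hβ hγ
  obtain ⟨D', hD', hlim⟩ := hii μ hμ T hT
  have hDD : D = D' := funext fun N => tendsto_nhds_unique (hD N) (hD' N)
  refine ⟨κ T, hκ T hT, ?_⟩
  have hlimD : Tendsto D atTop (𝓝 (κ T)) := hDD ▸ hlim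
  refine hlimD.congr' ?_
  filter_upwards [eventually_gt_atTop 0] with N hN using hDE N hN

/-- **NECESSITY of every rung `ρ < 1`.**  From `(N−1)γE_N → κ > 0`: for `N` large `1/E_N` lies between `(N−1)γ/(κ(1+η))` and
`(N−1)γ/(κ(1−η))`, `η = (1−ρ)/2`, so `ρ·(1/E_u + 1/E_v) ≤ ρ(u+v−2)γ/(κ(1−η)) ≤ (u+v−1)γ/(κ(1+η)) ≤ 1/E_{u+v}` (buffer `L₀ = 0`).
Hence `SeriesRatioLaw ρ` is implied by the conjunct: it is a WEAKER piece. [folklore] -/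
theorem seriesRatioLaw_of_fouriersLaw {ρ : ℝ} (hρ1 : ρ < 1) (hF : _root_.FouriersLaw) : SeriesRatioLaw ρ := by
  rcases le_or_gt ρ 0 with hρ0 | hρ0
  · exact seriesRatioLaw_of_nonpos hρ0
  intro ω₂ lam β γ hω hl hβ hγ T hT
  obtain ⟨κ, hκ, hlim⟩ := escapeAsymptotics_of_fouriersLaw hF hω hl hβ hγ hT
  set E : ℕ → ℝ := fun N => escapeDeficit ω₂ lam β γ T N with hEdef
  have hpos : ∀ N : ℕ, 2 ≤ N → 0 < E N := fun N hN => JunctionDefectGrading.escapeDeficit_pos hω hl hβ hγ hT hN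
  -- `η = (1 − ρ)/2`, so that `ρ(1+η) ≤ 1 − η`
  obtain ⟨η, hη⟩ : ∃ η : ℝ, η = (1 - ρ) / 2 := ⟨_, rfl⟩
  have hη0 : 0 < η := by rw [hη]; linarith
  have hη1 : η < 1 := by rw [hη]; linarith
  have hρη : ρ * (1 + η) ≤ 1 - η := by rw [hη]; nlinarith
  obtain ⟨N₁, hN₁⟩ := Metric.tendsto_atTop.1 hlim (η * κ) (mul_pos hη0 hκ)
  refine ⟨0, max N₁ 2, fun u v hu hv => ?_⟩
  have hu1 : N₁ ≤ u := le_trans (le_max_left _ _) hu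
  have hv1 : N₁ ≤ v := le_trans (le_max_left _ _) hv
  have hu2 : 2 ≤ u := le_trans (le_max_right _ _) hu
  have hv2 : 2 ≤ v := le_trans (le_max_right _ _) hv
  have huR : (2 : ℝ) ≤ u := by exact_mod_cast hu2
  have hvR : (2 : ℝ) ≤ v := by exact_mod_cast hv2
  -- the three windows
  have hwin : ∀ N : ℕ, N₁ ≤ N → 2 ≤ N →
      κ * (1 - η) ≤ ((N : ℝ) - 1) * γ * E N ∧ ((N : ℝ) - 1) * γ * E N ≤ κ * (1 + η) := by
    intro N hN _
    have h := hN₁ N hN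
    rw [Real.dist_eq, abs_lt] at h
    constructor <;> nlinarith [h.1, h.2]
  obtain ⟨hlu, -⟩ := hwin u hu1 hu2
  obtain ⟨hlv, -⟩ := hwin v hv1 hv2
  obtain ⟨-, huw⟩ := hwin (u + 0 + v) (by omega) (by omega)
  have hEu := hpos u hu2
  have hEv := hpos v hv2
  have hEw := hpos (u + 0 + v) (by omega)
  have hκ1 : 0 < κ * (1 - η) := mul_pos hκ (by linarith)
  have hκ2 : 0 < κ * (1 + η) := mul_pos hκ (by linarith)
  have huγ : 0 < ((u : ℝ) - 1) * γ := mul_pos (by linarith) hγ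
  have hvγ : 0 < ((v : ℝ) - 1) * γ := mul_pos (by linarith) hγ
  have hwcast : (((u + 0 + v : ℕ) : ℝ)) = (u : ℝ) + v := by push_cast; ring
  rw [hwcast] at huw
  have hwγ : 0 < ((u : ℝ) + v - 1) * γ := mul_pos (by linarith) hγ
  -- upper bounds on `1/E_u`, `1/E_v`, lower bound on `1/E_{u+v}`
  have hIu : 1 / E u ≤ ((u : ℝ) - 1) * γ / (κ * (1 - η)) := by
    rw [div_le_div_iff₀ hEu hκ1]; linarith
  have hIv : 1 / E v ≤ ((v : ℝ) - 1) * γ / (κ * (1 - η)) := by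
    rw [div_le_div_iff₀ hEv hκ1]; linarith
  have hIw : ((u : ℝ) + v - 1) * γ / (κ * (1 + η)) ≤ 1 / E (u + 0 + v) := by
    rw [div_le_div_iff₀ hκ2 hEw]; linarith
  -- compare the two explicit bounds
  have hcmp : ρ * (((u : ℝ) - 1) * γ / (κ * (1 - η)) + ((v : ℝ) - 1) * γ / (κ * (1 - η)))
      ≤ ((u : ℝ) + v - 1) * γ / (κ * (1 + η)) := by
    rw [← add_div, ← mul_div_assoc, div_le_div_iff₀ hκ1 hκ2]
    have hsum : 0 ≤ ((u : ℝ) - 1) * γ + ((v : ℝ) - 1) * γ := by linarith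
    have h1 : ρ * (((u : ℝ) - 1) * γ + ((v : ℝ) - 1) * γ) * (κ * (1 + η))
        = (ρ * (1 + η)) * (((u : ℝ) - 1) * γ + ((v : ℝ) - 1) * γ) * κ := by ring
    have h2 : ((u : ℝ) + v - 1) * γ * (κ * (1 - η)) = (1 - η) * (((u : ℝ) + v - 1) * γ) * κ := by ring
    rw [h1, h2]
    have h3 : (ρ * (1 + η)) * (((u : ℝ) - 1) * γ + ((v : ℝ) - 1) * γ) ≤ (1 - η) * (((u : ℝ) - 1) * γ + ((v : ℝ) - 1) * γ) :=
      mul_le_mul_of_nonneg_right hρη hsum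
    have h4 : (1 - η) * (((u : ℝ) - 1) * γ + ((v : ℝ) - 1) * γ) ≤ (1 - η) * (((u : ℝ) + v - 1) * γ) :=
      mul_le_mul_of_nonneg_left (by nlinarith) (by linarith)
    exact mul_le_mul_of_nonneg_right (h3.trans h4) hκ.le
  calc ρ * (1 / E u + 1 / E v) ≤ ρ * (((u : ℝ) - 1) * γ / (κ * (1 - η)) + ((v : ℝ) - 1) * γ / (κ * (1 - η))) :=
        mul_le_mul_of_nonneg_left (add_le_add hIu hIv) hρ0.le
    _ ≤ ((u : ℝ) + v - 1) * γ / (κ * (1 + η)) := hcmp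
    _ ≤ 1 / E (u + 0 + v) := hIw

/-- **`FouriersLaw ⟹ AsymptoticSeriesLaw`**: the top of the necessary part of the ladder. [folklore] -/
theorem asymptoticSeriesLaw_of_fouriersLaw (hF : _root_.FouriersLaw) : AsymptoticSeriesLaw :=
  fun _ hρ => seriesRatioLaw_of_fouriersLaw hρ hF

end EscapeGrading

end Summit.AtomisticToContinuum.FouriersLaw.Theorems.SubdiffusiveBondHeat

end
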